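import Mathlib.Topology.MetricSpace.Contracting
import Summits.HodgeConjecture.HodgeConjecture.Theorems.F0P3cStCharTSRootCalculus   -- ★ `continuous_dividedDiff`, `dividedDiff_eq_sum_range`, `norm_eval_sub_eval_le`, `exists_root_unique_near`
import HarnessLib

/-!
# F0 · P3c · line LH6 «StCharTS» — «ROOT-PERSIST★»: a SIMPLE root of `p₀` persists as a root of every nearby polynomial
# (complete normed field; the existence half that ★ `F0P3cStCharTSRootCalculus` §3 «at most one root near a simple root» lacks)

Cell `pub/hodgecm-mathlib`, crux H413 = `stmt-HodgeConjecture-24833` (lane `--supports … --as helper`), route HCCMUnconditional; seat LH4-p03 (g7).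
THEOREMS ONLY over Mathlib + ★ `Summits…Theorems.F0P3cStCharTSRootCalculus` (+ its import ★ `Literature.LinearAlgebra.Matrix.CharpolyLocalRigidity`);
no definition ∕ instance ∕ notation ∕ named fact ∕ `sorry`.  Consumer (datum road MAP-DATUM-ROAD v4, slice S13b «UPR-LC», road (I) «root continuity in
`L_w`» of F0P3-p02 (g20) 2026-09-02T12:42Z): the norm-one roots of `charpoly y` MOVE CONTINUOUSLY with `y` — ★ §3 gives uniqueness, ★ §2 gives «no new
roots», this file gives EXISTENCE.

THE MATHEMATICS (`K` a COMPLETE normed field — no ultrametricity, no properness, no extension of the absolute value; simplified Newton ∕ chord method).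
Fix `p₀ ∈ K[X]` with `natDegree p₀ < N`, a root `a ∈ K` with `c := p₀′(a) ≠ 0`.
* §1 `exists_isFixedPt_mem_closedBall`: Banach's fixed point theorem on a closed ball (Mathlib `ContractingWith.exists_fixedPoint'` on the complete
  subset `closedBall a r`; the pattern of ★ `Literature.Analysis.Calculus.QuadraticFixedPoint` ∕ `PadicChordMethod`).
* §2 `exists_root_near_of_simple_root` (P1): for every `η > 0` there is `ρ > 0` such that every `p` with `natDegree p < N` and coefficients within `ρ`
  of those of `p₀` has a root `r ∈ K` with `‖r − a‖ < η`.  Proof: the chord map `T x = x − c⁻¹ · p(x)` satisfies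
  `T x − T y = c⁻¹ (c − D_N(p; y, x)) (x − y)` (★ `aeval_sub_aeval_eq_dividedDiff_mul`), and the divided difference `D_N(p; y, x) → c` jointly in
  `(coeff p, x, y) → (coeff p₀, a, a)` (★ `continuous_dividedDiff`, ★ `dividedDiff_self`); so on a small closed ball `closedBall a r` and for `p`
  close to `p₀`, `T` is a `½`-contraction of the ball into itself (`‖T a − a‖ = ‖c⁻¹ p(a)‖ = ‖c⁻¹ (p − p₀)(a)‖ ≤ r∕2` by ★ `norm_eval_sub_eval_le`);
  its fixed point is the root.
* §3 `existsUnique_root_near_of_simple_root` (P2): a window `δ ∈ (0, η]` and `ρ > 0` such that every such `p` has EXACTLY ONE root in `B(a, δ)`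
  (P1 + ★ `exists_root_unique_near`); same-degree dresses (P3) `…_le` (`natDegree p ≤ natDegree p₀`, no `N`).
HONEST LABEL: HC_CM is proved only modulo the 7 printed citations (2 remaining named inputs: hLiu418 = `stmt-HodgeConjecture-24832`, h413 =
`stmt-HodgeConjecture-24833`) until rung 0 closes; this file closes no organ (count-neutral datum-road brick).

## References
* [Gouvea1993PadicNumbers] F. Q. Gouvêa, *p-adic Numbers*, Universitext (1993∕1997), §3.4 (Hensel's lemma as Newton's method), §6.8 (continuity of roots).
* J. Dieudonné, *Foundations of Modern Analysis* (1969), (10.1.1)–(10.2.1) (fixed points and implicit functions).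
* [Rogawski1990] J. D. Rogawski, *Automorphic Representations of Unitary Groups in Three Variables*, Ann. of Math. Stud. 123 (1990), §12.5 pp. 182–184.
-/

set_option autoImplicit false
-- the mandated namespace has the single-problem summit's repeated segment (`HodgeConjecture.HodgeConjecture`)
set_option linter.dupNamespace false

noncomputable section

open Polynomial Filter Topology Metric Set
open Summit.HodgeConjecture.HodgeConjecture.Cruxes.H413.F0P3cStCharTSRootCalculus
  (continuous_dividedDiff dividedDiff_eq_sum_range norm_eval_sub_eval_le exists_root_unique_near)

namespace Summit.HodgeConjecture.HodgeConjecture.Cruxes.H413.F0P3cStCharTSRootPersist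

variable {K : Type*} [NormedField K]

/-! ## §1 Banach's fixed point theorem on a closed ball -/

/-- **Banach on a closed ball.**  In a complete normed field, a self-map of `closedBall a r` which is `c`-Lipschitz there with `c < 1` has a fixed
point in the ball (Mathlib `ContractingWith.exists_fixedPoint'` on the complete subset `closedBall a r`). [folklore] -/
theorem exists_isFixedPt_mem_closedBall [CompleteSpace K] {f : K → K} {a : K} {r : ℝ} (hr : 0 ≤ r) {c : NNReal} (hc : c < 1)
    (hmaps : MapsTo f (closedBall a r) (closedBall a r)) (hlip : LipschitzOnWith c f (closedBall a r)) :
    ∃ y ∈ closedBall a r, f y = y := by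
  have hsc : IsComplete (closedBall a r) := isClosed_closedBall.isComplete
  have hf : ContractingWith c (hmaps.restrict f _ _) := ⟨hc, hlip.mapsToRestrict hmaps⟩
  obtain ⟨y, hy, hfix, -⟩ := hf.exists_fixedPoint' hsc hmaps (x := a) (mem_closedBall_self hr) (edist_ne_top _ _)
  exact ⟨y, hy, hfix⟩

/-! ## §2 Existence: a simple root persists (complete normed field) -/

/-- The divided-difference identity in `eval` form: `p(y) − p(x) = D_N(p; x, y) · (y − x)` for `natDegree p < N`, with
`D_N(p; x, y) = ∑_{k<N} p_k ∑_{j<k} y^j x^{k−1−j}` written as the continuous function of ★ `continuous_dividedDiff` at `(coeff p, x, y)`.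
[cite: Borel1991, IV.12.2] -/
theorem eval_sub_eval_eq_dividedDiff_mul {p : K[X]} {N : ℕ} (hp : p.natDegree < N) (x y : K) :
    p.eval y - p.eval x =
      (∑ k : Fin N, (fun i : Fin N => p.coeff i) k * ∑ j ∈ Finset.range k, y ^ j * x ^ ((k : ℕ) - 1 - j)) * (y - x) := by
  have hid := Literature.LinearAlgebra.Matrix.aeval_sub_aeval_eq_dividedDiff_mul p hp (Commute.all x y)
  rw [coe_aeval_eq_eval, coe_aeval_eq_eval, ← dividedDiff_eq_sum_range N p x y] at hid
  exact hid

/-- **A simple root persists (P1).**  `K` a complete normed field, `natDegree p₀ < N`, `p₀(a) = 0`, `p₀′(a) ≠ 0`.  For every `η > 0` there is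
`ρ > 0` such that every `p ∈ K[X]` with `natDegree p < N` and `‖p_i − p₀,i‖ < ρ` for all `i` has a root `r ∈ K` with `‖r − a‖ < η`
(simplified Newton: the fixed point of the `½`-contraction `x ↦ x − p₀′(a)⁻¹ p(x)` of a small closed ball around `a`). [folklore] -/
theorem exists_root_near_of_simple_root [CompleteSpace K] {p₀ : K[X]} {N : ℕ} (h₀ : p₀.natDegree < N) {a : K}
    (ha₀ : p₀.IsRoot a) (ha : (derivative p₀).eval a ≠ 0) {η : ℝ} (hη : 0 < η) :
    ∃ ρ : ℝ, 0 < ρ ∧ ∀ p : K[X], p.natDegree < N → (∀ i, ‖p.coeff i - p₀.coeff i‖ < ρ) →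
      ∃ r : K, p.IsRoot r ∧ ‖r - a‖ < η := by
  -- notation: `c = p₀′(a)`, the divided difference `Φ` as a continuous function of `(coeff, x, y)`
  set c : K := (derivative p₀).eval a with hc
  have hc0 : c ≠ 0 := ha
  have hcpos : 0 < ‖c‖ := norm_pos_iff.2 hc0
  set Φ : (Fin N → K) × (K × K) → K :=
    fun z => ∑ k : Fin N, z.1 k * ∑ j ∈ Finset.range k, z.2.2 ^ j * z.2.1 ^ ((k : ℕ) - 1 - j) with hΦ
  set z₀ : (Fin N → K) × (K × K) := (fun i : Fin N => p₀.coeff i, (a, a)) with hz₀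
  have hΦz₀ : Φ z₀ = c := by
    rw [hΦ, hz₀]
    dsimp only
    rw [dividedDiff_eq_sum_range N p₀ a a, Literature.LinearAlgebra.Matrix.dividedDiff_self p₀ h₀ a, coe_aeval_eq_eval]
  -- STEP 1: a radius `ρ₁` on which `‖Φ − c‖ < ‖c‖/2`
  have hU : IsOpen (Φ ⁻¹' ball c (‖c‖ / 2)) := isOpen_ball.preimage (continuous_dividedDiff N)
  have hz₀U : z₀ ∈ Φ ⁻¹' ball c (‖c‖ / 2) := by
    rw [Set.mem_preimage, hΦz₀]; exact mem_ball_self (half_pos hcpos)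
  obtain ⟨ρ₁, hρ₁, hball⟩ := Metric.isOpen_iff.1 hU z₀ hz₀U
  have hnear : ∀ p : K[X], (∀ i, ‖p.coeff i - p₀.coeff i‖ < ρ₁) → ∀ x y : K, ‖x - a‖ < ρ₁ → ‖y - a‖ < ρ₁ →
      ‖Φ (fun i : Fin N => p.coeff i, (x, y)) - c‖ < ‖c‖ / 2 := by
    intro p hcoeff x y hx hy
    have hzball : ((fun i : Fin N => p.coeff i, (x, y)) : (Fin N → K) × (K × K)) ∈ ball z₀ ρ₁ := by
      rw [mem_ball, Prod.dist_eq, max_lt_iff, Prod.dist_eq, max_lt_iff, dist_pi_lt_iff hρ₁]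
      refine ⟨fun i => ?_, ?_, ?_⟩
      · rw [dist_eq_norm]; exact hcoeff i
      · rw [dist_eq_norm]; exact hx
      · rw [dist_eq_norm]; exact hy
    have := hball hzball
    rw [Set.mem_preimage, mem_ball, dist_eq_norm] at this
    exact this
  -- STEP 2: radii.  `r` = radius of the ball on which Newton contracts; `M` bounds `‖(p − p₀)(a)‖ / ρ`
  set r : ℝ := min (ρ₁ / 2) (η / 2) with hr
  have hrpos : 0 < r := lt_min (half_pos hρ₁) (half_pos hη)
  have hrρ₁ : r < ρ₁ := lt_of_le_of_lt (min_le_left _ _) (half_lt_self hρ₁)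
  have hrη : r < η := lt_of_le_of_lt (min_le_right _ _) (half_lt_self hη)
  set C : ℝ := max 1 ‖a‖ with hC
  have hC1 : 1 ≤ C := le_max_left _ _
  have haC : ‖a‖ ≤ C := le_max_right _ _
  set M : ℝ := N * C ^ (N - 1) with hM
  have hM0 : 0 ≤ M := mul_nonneg (Nat.cast_nonneg _) (pow_nonneg (le_trans zero_le_one hC1) _)
  set ρ : ℝ := min ρ₁ (r * ‖c‖ / (2 * (M + 1))) with hρ
  have hM1 : 0 < 2 * (M + 1) := by positivity
  have hρpos : 0 < ρ := lt_min hρ₁ (div_pos (mul_pos hrpos hcpos) hM1)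
  have hρρ₁ : ρ ≤ ρ₁ := min_le_left _ _
  have hρM : ρ * M ≤ r * ‖c‖ / 2 := by
    calc ρ * M ≤ r * ‖c‖ / (2 * (M + 1)) * M := mul_le_mul_of_nonneg_right (min_le_right _ _) hM0
      _ = r * ‖c‖ / 2 * (M / (M + 1)) := by field_simp
      _ ≤ r * ‖c‖ / 2 * 1 := by
          refine mul_le_mul_of_nonneg_left ?_ (by positivity)
          rw [div_le_one (by positivity)]; linarith
      _ = r * ‖c‖ / 2 := mul_one _
  refine ⟨ρ, hρpos, fun p hp hcoeff => ?_⟩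
  -- STEP 3: the chord map `T` and its Lipschitz estimate on `closedBall a r`
  set T : K → K := fun x => x - c⁻¹ * p.eval x with hT
  have hcoeff₁ : ∀ i, ‖p.coeff i - p₀.coeff i‖ < ρ₁ := fun i => lt_of_lt_of_le (hcoeff i) hρρ₁
  have hTsub : ∀ x y : K, T x - T y = c⁻¹ * (c - Φ (fun i : Fin N => p.coeff i, (y, x))) * (x - y) := by
    intro x y
    have hid := eval_sub_eval_eq_dividedDiff_mul hp y x
    -- `p x − p y = Φ(coeff p, (y, x)) · (x − y)`
    have hid' : p.eval x - p.eval y = Φ (fun i : Fin N => p.coeff i, (y, x)) * (x - y) := by rw [hΦ]; exact hid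
    simp only [hT]
    rw [show x - c⁻¹ * p.eval x - (y - c⁻¹ * p.eval y) = (x - y) - c⁻¹ * (p.eval x - p.eval y) by ring, hid']
    field_simp
  have hlipr : ∀ x ∈ closedBall a r, ∀ y ∈ closedBall a r, dist (T x) (T y) ≤ (1 / 2 : ℝ) * dist x y := by
    intro x hx y hy
    rw [mem_closedBall, dist_eq_norm] at hx hy
    have hx' : ‖x - a‖ < ρ₁ := lt_of_le_of_lt hx hrρ₁
    have hy' : ‖y - a‖ < ρ₁ := lt_of_le_of_lt hy hrρ₁
    have hD := hnear p hcoeff₁ y x hy' hx'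
    rw [dist_eq_norm, dist_eq_norm, hTsub x y, norm_mul, norm_mul, norm_inv, ← norm_neg (Φ _ - c), neg_sub] at *
    calc ‖c‖⁻¹ * ‖c - Φ (fun i : Fin N => p.coeff i, (y, x))‖ * ‖x - y‖
        ≤ ‖c‖⁻¹ * (‖c‖ / 2) * ‖x - y‖ := by
          refine mul_le_mul_of_nonneg_right ?_ (norm_nonneg _)
          exact mul_le_mul_of_nonneg_left hD.le (inv_nonneg.2 (norm_nonneg _))
      _ = (1 / 2 : ℝ) * ‖x - y‖ := by field_simp
  have hlip : LipschitzOnWith ((1 : NNReal) / 2) T (closedBall a r) := by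
    refine LipschitzOnWith.of_dist_le_mul fun x hx y hy => ?_
    rw [show (((1 : NNReal) / 2 : NNReal) : ℝ) = 1 / 2 by norm_num]
    exact hlipr x hx y hy
  -- STEP 4: `T` maps the ball into itself: `‖T a − a‖ = ‖c⁻¹ p(a)‖ ≤ r/2`
  have hpa : ‖p.eval a‖ ≤ ρ * M := by
    have h := norm_eval_sub_eval_le h₀ hp hρpos.le (fun i => (hcoeff i).le) hC1 haC
    rw [ha₀.eq_zero, zero_sub, norm_neg] at h
    calc ‖p.eval a‖ ≤ N * ρ * C ^ (N - 1) := h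
      _ = ρ * M := by rw [hM]; ring
  have hTa : ‖T a - a‖ ≤ r / 2 := by
    have h1 : T a - a = -(c⁻¹ * p.eval a) := by simp only [hT]; ring
    rw [h1, norm_neg, norm_mul, norm_inv]
    calc ‖c‖⁻¹ * ‖p.eval a‖ ≤ ‖c‖⁻¹ * (ρ * M) := mul_le_mul_of_nonneg_left hpa (inv_nonneg.2 (norm_nonneg _))
      _ ≤ ‖c‖⁻¹ * (r * ‖c‖ / 2) := mul_le_mul_of_nonneg_left hρM (inv_nonneg.2 (norm_nonneg _))
      _ = r / 2 := by field_simp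
  have hmaps : MapsTo T (closedBall a r) (closedBall a r) := by
    intro x hx
    have hx' := hx
    rw [mem_closedBall, dist_eq_norm] at hx' ⊢
    have h1 : T x - a = (T x - T a) + (T a - a) := by ring
    have h2 : ‖T x - T a‖ ≤ (1 / 2 : ℝ) * ‖x - a‖ := by
      have := hlipr x hx a (mem_closedBall_self hrpos.le)
      rwa [dist_eq_norm, dist_eq_norm] at this
    calc ‖T x - a‖ = ‖(T x - T a) + (T a - a)‖ := by rw [h1]
      _ ≤ ‖T x - T a‖ + ‖T a - a‖ := norm_add_le _ _
      _ ≤ (1 / 2 : ℝ) * ‖x - a‖ + r / 2 := add_le_add h2 hTa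
      _ ≤ (1 / 2 : ℝ) * r + r / 2 := by linarith [mul_le_mul_of_nonneg_left hx' (by norm_num : (0 : ℝ) ≤ 1 / 2)]
      _ = r := by ring
  -- STEP 5: the fixed point is a root within `r < η` of `a`
  have hhalf : ((1 : NNReal) / 2) < 1 := by norm_num
  obtain ⟨y, hy, hfix⟩ := exists_isFixedPt_mem_closedBall hrpos.le hhalf hmaps hlip
  refine ⟨y, ?_, ?_⟩
  · have h1 : c⁻¹ * p.eval y = 0 := by
      have h2 : y - c⁻¹ * p.eval y = y := hfix
      linear_combination (-1 : K) * h2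
    rcases mul_eq_zero.1 h1 with h | h
    · exact absurd h (inv_ne_zero hc0)
    · exact h
  · rw [mem_closedBall, dist_eq_norm] at hy
    exact lt_of_le_of_lt hy hrη

/-! ## §3 Exactly one root near a simple root; same-degree dresses -/

/-- **Exactly one root in a fixed window (P2).**  `K` complete, `natDegree p₀ < N`, `p₀(a) = 0`, `p₀′(a) ≠ 0`, `η > 0`: there are a window
`0 < δ ≤ η` and `ρ > 0` such that every `p` with `natDegree p < N` and coefficients within `ρ` of those of `p₀` has EXACTLY ONE root `r ∈ K` with
`‖r − a‖ < δ` (P1 for existence, ★ `exists_root_unique_near` for uniqueness). [folklore] -/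
theorem existsUnique_root_near_of_simple_root [CompleteSpace K] {p₀ : K[X]} {N : ℕ} (h₀ : p₀.natDegree < N) {a : K}
    (ha₀ : p₀.IsRoot a) (ha : (derivative p₀).eval a ≠ 0) {η : ℝ} (hη : 0 < η) :
    ∃ δ ρ : ℝ, 0 < δ ∧ δ ≤ η ∧ 0 < ρ ∧ ∀ p : K[X], p.natDegree < N → (∀ i, ‖p.coeff i - p₀.coeff i‖ < ρ) →
      ∃! r : K, p.IsRoot r ∧ ‖r - a‖ < δ := by
  obtain ⟨ρu, hρu, huniq⟩ := exists_root_unique_near h₀ ha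
  set δ : ℝ := min ρu η with hδ
  have hδpos : 0 < δ := lt_min hρu hη
  obtain ⟨ρe, hρe, hex⟩ := exists_root_near_of_simple_root h₀ ha₀ ha hδpos
  refine ⟨δ, min ρe ρu, hδpos, min_le_right _ _, lt_min hρe hρu, fun p hp hcoeff => ?_⟩
  obtain ⟨r, hr, hra⟩ := hex p hp fun i => lt_of_lt_of_le (hcoeff i) (min_le_left _ _)
  refine ⟨r, ⟨hr, hra⟩, fun r' hr' => ?_⟩
  exact huniq p hp (fun i => lt_of_lt_of_le (hcoeff i) (min_le_right _ _)) r' r hr'.1 hr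
    (lt_of_lt_of_le hr'.2 (min_le_left _ _)) (lt_of_lt_of_le hra (min_le_left _ _))

/-- **A simple root persists — same-degree dress (P3)** (for use next to ★ `exists_forall_root_near`, whose `p` ranges over monic polynomials of
degree `natDegree p₀`): `K` complete, `p₀(a) = 0`, `p₀′(a) ≠ 0`, `η > 0`; then for some `ρ > 0` every `p` with `natDegree p ≤ natDegree p₀` and
coefficients within `ρ` of those of `p₀` has a root within `η` of `a`. [folklore] -/
theorem exists_root_near_of_simple_root_le [CompleteSpace K] {p₀ : K[X]} {a : K}
    (ha₀ : p₀.IsRoot a) (ha : (derivative p₀).eval a ≠ 0) {η : ℝ} (hη : 0 < η) :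
    ∃ ρ : ℝ, 0 < ρ ∧ ∀ p : K[X], p.natDegree ≤ p₀.natDegree → (∀ i, ‖p.coeff i - p₀.coeff i‖ < ρ) →
      ∃ r : K, p.IsRoot r ∧ ‖r - a‖ < η := by
  obtain ⟨ρ, hρ, h⟩ := exists_root_near_of_simple_root (Nat.lt_succ_self p₀.natDegree) ha₀ ha hη
  exact ⟨ρ, hρ, fun p hdeg hcoeff => h p (Nat.lt_succ_of_le hdeg) hcoeff⟩

/-- **Exactly one root in a fixed window — same-degree dress (P3′).** [folklore] -/
theorem existsUnique_root_near_of_simple_root_le [CompleteSpace K] {p₀ : K[X]} {a : K}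
    (ha₀ : p₀.IsRoot a) (ha : (derivative p₀).eval a ≠ 0) {η : ℝ} (hη : 0 < η) :
    ∃ δ ρ : ℝ, 0 < δ ∧ δ ≤ η ∧ 0 < ρ ∧ ∀ p : K[X], p.natDegree ≤ p₀.natDegree → (∀ i, ‖p.coeff i - p₀.coeff i‖ < ρ) →
      ∃! r : K, p.IsRoot r ∧ ‖r - a‖ < δ := by
  obtain ⟨δ, ρ, hδ, hδη, hρ, h⟩ := existsUnique_root_near_of_simple_root (Nat.lt_succ_self p₀.natDegree) ha₀ ha hη
  exact ⟨δ, ρ, hδ, hδη, hρ, fun p hdeg hcoeff => h p (Nat.lt_succ_of_le hdeg) hcoeff⟩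

end Summit.HodgeConjecture.HodgeConjecture.Cruxes.H413.F0P3cStCharTSRootPersist

end
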